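import Summits.QuantumFields.YangMills.Theorems.BalabanUVNodesN12AtRecord13OfResiduals
import Literature.MathematicalPhysics.QuantumFieldTheory.Balaban1983to89.Node00.Record13CarriersSepCoPH
import Literature.MathematicalPhysics.QuantumFieldTheory.Balaban1983to89.Node00.Record13SepCoPRInhabitedOfSepCoP

/-!
# BalabanUVNodes ∕ N12 — N12's CONJUNCTS OF THE K1⁷ RUNG v5 `NodesAtSomeRecord13PWS` (plan D71-REV24 `dryrun-skel/K1Skeleton13SepCoPHv5.lean` = the registered v4 rung of stmt-QuantumFields-20507 under T₇:
# the S-BOUND world class `RecordS F θ h w` — node00-def-T's `IsRecordOfRecord₁₃CSepCoPH` (FILE 28T p539169) at the presenting pair with `upOfRecord₅C ↦ upOfRecord₅CS` (node00-def `CarriersB8`: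
# the C-binding with `b8` re-bound to [6] Thm 8's SURVIVING form) — and N12 PINNED BY NAME: `∃ λ, (∀ P, 1 ≤ P.K → λ.kSel P < P.K) ∧ ∀ P, λ.kSel P < P.K → ((leavesP w P).rBasicStep ↔
# B15Leaf (WOfRecord₁₃ F 2 θ.toStage13Params λ P))`) AT AN S-BOUND W-PINNED WORLD of a v1.7 parameter `θ : Stage13HParams` (rev 24, `CoPH`: FINDING №9 ∕ director-ym №183 H1ʰ ∕ №186 (α) ∕
# PRESS WORD №190; def-T FILE 27∕28T, dag-n10-d `Record13Carriers(Sep)CoPH` W1 p539476 ∕ W2, node00-def-K0a FILE 18), N12's row resolved at the H-EXTENSION `⟨⟨Θ.liveRepin₁₃, Zr⟩, Zh, Phih⟩` of the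
# live re-pin and at the DOOR-CURED PIN `Stage13HParams.ofHistoryBlind (Stage13RParams.ofCured (Θ.liveRepin₁₃))` — the T₇ twin of this seat's 12V `BalabanUVNodesN12AtRecord13SepCoPRS` (p533756)
# (Track A, DAG node N12 = [B15, Balaban1989LargeFieldI] CMP **122** (1989) 175–202; cluster K1: K1⁷ `StabilityBAtRecordR13SepCoPH`, stubs `stub_nodes13PWS` ∕ `stub_betaWindow13PWS` under T₇;
# the ⁶ key stmt-QuantumFields-20507 STANDS until «KEY-24 SERVED»; seat `pub-ymgap-dag-n12-d` g12 (R134 s2), 2026-08-27; count-neutral, NOT a discharge)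

HONEST FRAMING.  Count-neutral kernel COMPOSITION BY NAME (every proof term is 12V's under T₇ plus the door faces of FILE 27 §H1 ∕ 28T §H2).  `RecordS` is SKELETON-LOCAL (plan; dag-n10-d's
tree twin `IsRecordOfRecord₁₃CSepCoPHS` = W5 is `Iff.rfl` to it), so its ∃-body is stated LITERALLY here, at general `N` (at `N := 2` the ★★ conclusions below ARE `NodesAtSomeRecord13PWS F`'s body
with `RecordS` unfolded, EXCEPT that `∀ P, Nodes (leavesP w P)` is REPLACED by N12's conjunct `∀ P, Dag.B15_main (leavesP w P)` and print's [B10] sentence `PrintedUV3V 2 θ.L` (N08) is NOT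
claimed — N12 ALONE at its own world; NOT the stub; the joint body over all thirteen nodes is this seat's 12T-H `…N12AtRecord13SepCoPHSockets`).  The S-binding never touches the `rBasicStep`
leaf (`CarriersB8.upOfRecord₅CS_eq_withB8`, `B8LeafKnitRS.withB8_leaves`: `rfl`), so at the S-binding of a W-pinned Stage-13 view the leaf the DAG reads IS `B15Leaf (W₀ P)` (g30's
`upOfRecord₅C_pinW_rBasicStep_iff` through dag-n10-d's `toStage5₁₃CoPH_pinW`, `rfl`); the presenting parameter of `RecordS` is the H-level W-pinned `θ.pinW W₀` (dag-n10-d W2: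
`Provisos₁₃SepCoPH.pinW`, `datumOfRecord₁₃SepCoPH_pinW` `rfl`).  THE MIXED W-PIN (this seat's 12J §3): `W₀` agrees with NODE 00's bundle of record `WOfRecord₁₃ θ.toStage13Params λ P` on the runs
whose selected step is a printed step (`λ.kSel P < P.K`) and is the degenerate leaf-carrier (g4 `exists_printedCarriers15_b15Leaf`) elsewhere; WITH the v5 selector bound `hsel : ∀ P, 1 ≤ P.K →
λ.kSel P < P.K` (DISPLAYED — WHICH step per run stays `ResidW.kSel`'s located question) the degenerate branch fires only at `K = 0`, where print applies no basic step: so N12's per-run displays —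
the (1.100) pin equation, live-mass (NODE 00), Proposition 1 (1.78) (dag-n12-c's letters via 12Q′), (1.80), (1.89) (dag-n12-e's pins ∕ N07-at-objects) — are owed at one genuine step of EVERY run
with steps, by 12E's proviso-free ★★ row at `Θ.liveRepin₁₃ = (⟨⟨Θ.liveRepin₁₃, Zr⟩, Zh, Phih⟩ : Stage13HParams).toStage13Params` (`rfl`) — N12 READS NO 𝐓-WEIGHT (neither `Zr` nor `Zh` nor `Phih`;
`WOfRecord₁₃` ∕ `reprTOfRecord₁₃` ∕ `gOfRecord₁₃` are NOT re-issued at v1.7).  K1⁷'s guard: `SlotsNondegenerate₁₃` a theorem of K0b's residuals (K0a FILE 9 v1.1), `ZhUnity` DISPLAYED at a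
generic H-extension and a THEOREM at the door-cured pin (`(zrUnity_ofCured _).ofHistoryBlind`), where the v1.7 provisos come from the v1.5 ones (`Provisos₁₃SepCoP.ofCured`, then
`Provisos₁₃SepCoPR.ofHistoryBlind`).  ONE-WAY (FILE 27 §H1): the door-cured pin is history-BLIND — the image of the K0⁶ → K0⁷ witness road (bridge ⁷ ⇐ ⁶ `IsRecordOfRecord₁₃CSepCoPH.ofCoPR`), not
print's history-reading weights; §2 is the socket for those.  Nothing of Bałaban's is asserted or proved; NO estimate; N12 is NOT discharged; no node is discharged; counts unmoved (Track A
discharged 5∕28); a re-key is not progress.  ONE finite four-torus programme at fixed `ε = L^{-K}` — nothing continuum ∕ ℝ⁴ ∕ OS ∕ mass gap ∕ Clay.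

WHAT THIS FILE GIVES (all count-neutral; T₇ twins of 12V's):
* §1 ENGINES (generic `θ : Stage13HParams`, `h : Provisos₁₃SepCoPH`): `recordS₁₃SepCoPH_of_upS_pinW` (a world S-bound to the W-pinned view IS in `RecordS F θ h w`, pointed),
  `exists_pinWWorldS_recordS₁₃SepCoPH_b15_main_of_leaf` (any leaf-carrying `W₀`), `exists_mixedPinWS_recordS₁₃SepCoPH_b15_main_pinnedN12_of_leafBelow` (mixed W-pin + the v5 N12 conjunct at `λ`).
* §2 ★★ `exists_guarded_recordS₁₃SepCoPH_b15_main_pinnedN12_liveRepin₁₃H_of_massLive_of_hasResiduals` — THE v5 RUNG SHAPE RESTRICTED TO N12 at `⟨⟨Θ.liveRepin₁₃, Zr⟩, Zh, Phih⟩` (`hZh`, `hsel` displayed).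
* §3 ★★ `…_ofHistoryBlind_ofCured_liveRepin₁₃_…` — at the door-cured pin: `ZhUnity` DISCHARGED; K1⁷-side input the v1.5 `hP : (Θ.liveRepin₁₃).Provisos₁₃SepCoP` (K1⁵'s input verbatim, lifted by
  `.ofCured.ofHistoryBlind`).
* §4 ★★★ `…_ofHistoryBlind_ofCured_theta13OfThm1C_…` — at the door-cured pin of the plan's witness `θ₁₅ᶜ`.

Sources: [Balaban1989LargeFieldII] Thm 1 + (0.1) pp.355–356, p.391; [Balaban1989LargeFieldI] (0.1) p.175, (0.2)–(0.6) p.176, p.177 (i)–(ii), Prop. 1 (1.78) p.194, (1.80) p.195, (1.89) p.198,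
(1.99)–(1.102) pp.200–201; [Balaban1988Convergent] (1.11) p.248, p.257, (2.20)–(2.22) p.258, (3.16)–(3.25) pp.268–270; [Balaban1985RegularSpaces] Thm 8 p.101 (surviving form; the S-binding; bookkeeping).
-/

noncomputable section

open MeasureTheory
open scoped Matrix.Norms.L2Operator

namespace Summit.QuantumFields.YangMills.BalabanUVNodes.N12AtRecord13SepCoPHS

open Literature.MathematicalPhysics.QuantumFieldTheory.Balaban1983to89
open Literature.MathematicalPhysics.QuantumFieldTheory.Balaban1983to89.T4Continuum (T4Family)
open Literature.MathematicalPhysics.QuantumFieldTheory.Balaban1983to89.DagBinding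
open Literature.MathematicalPhysics.QuantumFieldTheory.Balaban1983to89.Node00
open B15Claim189Assembly (new189 chiPP dom)
open B15 (Prop1Printed Ineq180)
open B15.BasicStep (Claim189)
open B8Eq17ClassAkV1 (plaqsOf)
open B15RPrime1100OfRep (rPrimeDataOfSel)
open Summit.QuantumFields.YangMills.BalabanUVNodes.N12AtRecord13OfResiduals (b15Leaf_WOfRecord₁₃_liveRepin₁₃_of_massLive_of_hasResiduals)

variable {N : ℕ} [NeZero N] {F : T4Family}

/-! ## §1 ENGINES at a generic v1.7 parameter: the S-bound W-pinned world IS in `RecordS`; its `rBasicStep` leaf IS `B15Leaf (W₀ P)`; the mixed W-pin and the v5 N12 conjunct -/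

section Engines
variable (θ : Stage13HParams F N)

/-- **A WORLD S-BOUND TO THE W-PINNED STAGE-13 VIEW OF `θ` IS IN `RecordS F θ h w`** (plan v3.1∕v4∕v5, stated literally at general `N`; pointed): presenting parameter the H-level W-pinned
`θ.pinW W₀` (dag-n10-d W1 `Record13CarriersCoPH` §0: `onBase`, `Zh` ∕ `Phih` kept; admissibility `Stage13Params.pinW_admissible_iff` at `θ.toStage13Params`), its v1.4-range provisos `h.pinW W₀`
(W2 `Record13CarriersSepCoPH`), SAME datum (`datumOfRecord₁₃SepCoPH_pinW`, `rfl`), the S-binding over `(θ.pinW W₀).toStage5₁₃CoPH`.  Bookkeeping. [cite: Balaban1989LargeFieldII, Thm 1 + (0.1) pp.355–356; Balaban1985RegularSpaces, Thm 8 p.101 (surviving form; bookkeeping)] -/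
theorem recordS₁₃SepCoPH_of_upS_pinW (h : θ.Provisos₁₃SepCoPH F N) (hθ : θ.Admissible F N) (W₀ : B12.RunParams → PrintedCarriers15) (w : WorldP)
    (hC : w.C = (datumOfRecord₁₃SepCoPH F N θ h).C) (hγ : 0 < w.γ ∧ w.γ ≤ θ.γ) (hL : w.L = (θ.L : ℝ))
    (hup : ∀ P, w.up P = upOfRecord₅CS F N ((θ.pinW F N W₀).toStage5₁₃CoPH F N) P) :
    (∃ (θ'' : Stage13HParams F N) (h'' : θ''.Provisos₁₃SepCoPH F N), θ''.Admissible F N ∧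
      datumOfRecord₁₃SepCoPH F N θ h = datumOfRecord₁₃SepCoPH F N θ'' h'' ∧ w.C = (datumOfRecord₁₃SepCoPH F N θ h).C ∧ (0 < w.γ ∧ w.γ ≤ θ''.γ) ∧
      w.L = (θ''.L : ℝ) ∧ ∀ P : B12.RunParams, w.up P = upOfRecord₅CS F N (θ''.toStage5₁₃CoPH F N) P) :=
  ⟨θ.pinW F N W₀, h.pinW W₀, (Stage13Params.pinW_admissible_iff F N θ.toStage13Params W₀).2 hθ, rfl, hC, hγ, hL, hup⟩

/-- **FOR EVERY ADMISSIBLE v1.7 PACKAGE WITH THE v1.4-RANGE PROVISOS AND ANY PER-RUN [IV] BUNDLE FAMILY `W₀` CARRYING THE LEAF, THE WORLD S-BOUND TO THE W-PINNED STAGE-13 VIEW IS IN `RecordS F θ h ·`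
(any window `γw ∈ ]0, θ.γ]`, block size `θ.L`), ITS `rBasicStep` LEAF IS `B15Leaf (W₀ P)`, AND `Dag.B15_main` HOLDS AT EVERY RUN** — the S-binding re-binds `b8` only (`upOfRecord₅CS_eq_withB8`,
`withB8_leaves`, `rfl`), so g30's `upOfRecord₅C_pinW_rBasicStep_iff` reads the leaf back through dag-n10-d's `toStage5₁₃CoPH_pinW` (`rfl`).  HONESTY (R433 species, this seat's g4
`exists_printedCarriers15_b15Leaf`): at a GENERIC `W₀` the leaf is junk-inhabitable — the contentful forms read `W₀` at the bundle of record below the torus (the mixed W-pin, next).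
[cite: Balaban1989LargeFieldI, (0.2)–(0.6) p.176, Prop. 1 p.194; Balaban1989LargeFieldII, Thm 1 + (0.1) pp.355–356; Balaban1985RegularSpaces, Thm 8 p.101 (surviving form; bookkeeping)] -/
theorem exists_pinWWorldS_recordS₁₃SepCoPH_b15_main_of_leaf (h : θ.Provisos₁₃SepCoPH F N) (hθ : θ.Admissible F N) (W₀ : B12.RunParams → PrintedCarriers15)
    {γw : ℝ} (hγw : 0 < γw ∧ γw ≤ θ.γ) (hleaf : ∀ P, B15Leaf (W₀ P)) :
    ∃ w : WorldP,
      (∃ (θ'' : Stage13HParams F N) (h'' : θ''.Provisos₁₃SepCoPH F N), θ''.Admissible F N ∧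
        datumOfRecord₁₃SepCoPH F N θ h = datumOfRecord₁₃SepCoPH F N θ'' h'' ∧ w.C = (datumOfRecord₁₃SepCoPH F N θ h).C ∧ (0 < w.γ ∧ w.γ ≤ θ''.γ) ∧
        w.L = (θ''.L : ℝ) ∧ ∀ P : B12.RunParams, w.up P = upOfRecord₅CS F N (θ''.toStage5₁₃CoPH F N) P) ∧
      w.γ = γw ∧ w.L = (θ.L : ℝ) ∧ (∀ P, w.up P = upOfRecord₅CS F N ((θ.pinW F N W₀).toStage5₁₃CoPH F N) P) ∧
      (∀ P : B12.RunParams, ((leavesP w P).rBasicStep ↔ B15Leaf (W₀ P))) ∧ ∀ P : B12.RunParams, Dag.B15_main (leavesP w P) := by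
  obtain ⟨w₀⟩ := nonempty_worldP
  let w : WorldP :=
    { w₀ with
      C := (datumOfRecord₁₃SepCoPH F N θ h).C, γ := γw, L := (θ.L : ℝ), one_lt_L := by exact_mod_cast θ.hL.2,
      up := fun P => upOfRecord₅CS F N ((θ.pinW F N W₀).toStage5₁₃CoPH F N) P }
  have hrb : ∀ P : B12.RunParams, ((leavesP w P).rBasicStep ↔ B15Leaf (W₀ P)) := fun P =>
    show (upOfRecord₅CS F N ((θ.pinW F N W₀).toStage5₁₃CoPH F N) P).rBasicStep ↔ _ from
      upOfRecord₅C_pinW_rBasicStep_iff F N (θ.toStage5₁₃CoPH F N) W₀ P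
  refine ⟨w, recordS₁₃SepCoPH_of_upS_pinW θ h hθ W₀ w rfl hγw rfl (fun _ => rfl), rfl, rfl, fun _ => rfl, hrb, fun P => ?_⟩
  exact B15LeafKnit.b15_main_of_up (U := w.up P) rfl ((hrb P).2 (hleaf P))

/-- **THE MIXED W-PIN AT AN S-BOUND WORLD, WITH THE v4 N12 CONJUNCT**: for every admissible v1.7 package with the v1.4-range provisos and every residual layer `λ` whose bundle of record
`WOfRecord₁₃ θ.toStage13Params λ P` carries the leaf on the runs with `λ.kSel P < P.K`, there is a run-indexed [IV] family `W₀` AGREEING WITH THE BUNDLE OF RECORD ON THOSE RUNS and carrying the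
leaf everywhere (elsewhere: the degenerate leaf-carrier of g4 `exists_printedCarriers15_b15Leaf` — at `K = 0` print applies no basic step), whose S-bound W-pinned world is in `RecordS F θ h ·`
with `Dag.B15_main` at every run AND, on the runs below the torus, `(leavesP w P).rBasicStep ↔ B15Leaf (WOfRecord₁₃ θ.toStage13Params λ P)` — the K1⁷ v5 N12 pin read at THIS `λ`.
HONESTY: a junk demand removed, not a printed one; the per-run cost below the torus is unchanged. [cite: Balaban1989LargeFieldI, (0.1)–(0.6) pp.175–176, Prop. 1 p.194; Balaban1989LargeFieldII, Thm 1 + (0.1) pp.355–356; Balaban1985RegularSpaces, Thm 8 p.101 (surviving form; bookkeeping)] -/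
theorem exists_mixedPinWS_recordS₁₃SepCoPH_b15_main_pinnedN12_of_leafBelow (h : θ.Provisos₁₃SepCoPH F N) (hθ : θ.Admissible F N) (lamW : ResidW F N)
    {γw : ℝ} (hγw : 0 < γw ∧ γw ≤ θ.γ) (h12 : ∀ P : B12.RunParams, lamW.kSel P < P.K → B15Leaf (WOfRecord₁₃ F N θ.toStage13Params lamW P)) :
    ∃ W₀ : B12.RunParams → PrintedCarriers15, (∀ P : B12.RunParams, lamW.kSel P < P.K → W₀ P = WOfRecord₁₃ F N θ.toStage13Params lamW P) ∧ (∀ P, B15Leaf (W₀ P)) ∧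
      ∃ w : WorldP,
        (∃ (θ'' : Stage13HParams F N) (h'' : θ''.Provisos₁₃SepCoPH F N), θ''.Admissible F N ∧
          datumOfRecord₁₃SepCoPH F N θ h = datumOfRecord₁₃SepCoPH F N θ'' h'' ∧ w.C = (datumOfRecord₁₃SepCoPH F N θ h).C ∧ (0 < w.γ ∧ w.γ ≤ θ''.γ) ∧
          w.L = (θ''.L : ℝ) ∧ ∀ P : B12.RunParams, w.up P = upOfRecord₅CS F N (θ''.toStage5₁₃CoPH F N) P) ∧
        w.γ = γw ∧ w.L = (θ.L : ℝ) ∧ (∀ P, w.up P = upOfRecord₅CS F N ((θ.pinW F N W₀).toStage5₁₃CoPH F N) P) ∧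
        (∀ P : B12.RunParams, Dag.B15_main (leavesP w P)) ∧
        ∀ P : B12.RunParams, lamW.kSel P < P.K → ((leavesP w P).rBasicStep ↔ B15Leaf (WOfRecord₁₃ F N θ.toStage13Params lamW P)) := by
  obtain ⟨Wd, hWd⟩ := N12AtRecord12Pointed.exists_printedCarriers15_b15Leaf (F.P 0)
  let Wmix : B12.RunParams → PrintedCarriers15 := fun P => if lamW.kSel P < P.K then WOfRecord₁₃ F N θ.toStage13Params lamW P else Wd
  have hWmix : ∀ P : B12.RunParams, lamW.kSel P < P.K → Wmix P = WOfRecord₁₃ F N θ.toStage13Params lamW P := fun P hP => if_pos hP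
  have hleaf : ∀ P : B12.RunParams, B15Leaf (Wmix P) := fun P => by
    by_cases hP : lamW.kSel P < P.K
    · rw [hWmix P hP]; exact h12 P hP
    · show B15Leaf (if lamW.kSel P < P.K then WOfRecord₁₃ F N θ.toStage13Params lamW P else Wd)
      rw [if_neg hP]; exact hWd
  obtain ⟨w, hRS, hγ, hL, hup, hrb, hN⟩ := exists_pinWWorldS_recordS₁₃SepCoPH_b15_main_of_leaf θ h hθ Wmix hγw hleaf
  exact ⟨Wmix, hWmix, hleaf, w, hRS, hγ, hL, hup, hN, fun P hk => by rw [← hWmix P hk]; exact hrb P⟩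

end Engines

/-! ## §2 ★★ THE v5 RUNG SHAPE RESTRICTED TO N12, AT THE H-EXTENSION `⟨⟨Θ.liveRepin₁₃, Zr⟩, Zh, Phih⟩` of the live re-pin of a `Θ` carrying K0b's residuals (all three slots free; `hZh`, `hsel` displayed) -/

section LiveExtension
variable (Θ : Stage13Params F N) (Zr : (q : B12.RunParams) → TkResidualW F N (FluctV N) q.K)
  (Zh : (q : B12.RunParams) → ℕ → (ℕ → Set (Site (F.P q.K) 0)) → (ℕ → Set (Site (F.P q.K) 0)) → TkResidualW F N (FluctV N) q.K)
  (Phih : (q : B12.RunParams) → ℕ → (ℕ → Set (Site (F.P q.K) 0)) → (ℕ → Set (Site (F.P q.K) 0)) → (ℕ → Plaq (F.P q.K) 0 → ℝ)) (lamW : ResidW F N)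

/-- **★★ THE K1⁷ v5 RUNG `NodesAtSomeRecord13PWS` RESTRICTED TO N12 — `(ZhUnity ∧ SlotsNondegenerate₁₃) ∧ Admissible ∧ RecordS ∧ (∀ P, Dag.B15_main) ∧ ∃ λ, hsel ∧ the N12 pin` — WITNESSED BY
`(⟨⟨Θ.liveRepin₁₃, Zr⟩, Zh, Phih⟩, hP, w, λ := lamW)`**: the world is §1's S-bound MIXED-W-PINNED world of the extension; the slots guard by K0b's residuals (K0a FILE 9 v1.1 `slotsNondegenerate₁₃_liveRepin_of_hasResiduals`),
`ZhUnity` DISPLAYED (`hZh`; a theorem at the door-cured pin, §3), admissibility transported (`hθ.liveRepin₁₃`), N12's row below the torus by 12E's ★★ `b15Leaf_WOfRecord₁₃_liveRepin₁₃_of_massLive_of_hasResiduals`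
from the per-run displays `h12pin ∕ h12mass ∕ h12P1 ∕ h12i180 ∕ h12c189`, the v5 pin at `λ := lamW` with the selector bound `hsel` displayed.  K1⁷-SIDE INPUT: `hP : Provisos₁₃SepCoPH` AT THE EXTENSION.
NOT the stub (`Nodes ↦ Dag.B15_main`, no `PrintedUV3V`); count-neutral. [cite: Balaban1989LargeFieldII, Thm 1 p.355, (0.1) pp.355–356, p.391; Balaban1989LargeFieldI, (0.1) p.175, (0.2)–(0.6) p.176, p.177 (i)–(ii), Prop. 1 (1.78) p.194, (1.80) p.195, (1.89) p.198, (1.99)–(1.102) pp.200–201; Balaban1988Convergent, (1.11) p.248, (3.16)–(3.25) pp.268–270; Balaban1985RegularSpaces, Thm 8 p.101 (bookkeeping)] -/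
theorem exists_guarded_recordS₁₃SepCoPH_b15_main_pinnedN12_liveRepin₁₃H_of_massLive_of_hasResiduals (hres : Θ.HasResidualsOfRecord F N)
    (hP : (⟨⟨Θ.liveRepin₁₃ F N, Zr⟩, Zh, Phih⟩ : Stage13HParams F N).Provisos₁₃SepCoPH F N) (hθ : Θ.Admissible F N) (hZh : (⟨⟨Θ.liveRepin₁₃ F N, Zr⟩, Zh, Phih⟩ : Stage13HParams F N).ZhUnity F N)
    (h12pin : ∀ P : B12.RunParams, lamW.kSel P < P.K → lamW.D1100 P
      = rPrimeDataOfSel (reprTOfRecord₁₃ F N (Θ.liveRepin₁₃ F N) P (lamW.kSel P))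
          ((Θ.liveRepin₁₃ F N).ppSel P (gOfRecord₁₃ F N (Θ.liveRepin₁₃ F N) P) (lamW.kSel P + 1))
          (fibOfSeq F (Θ.liveRepin₁₃ F N).ν (Θ.liveRepin₁₃ F N).τ9 P (gOfRecord₁₃ F N (Θ.liveRepin₁₃ F N) P) (lamW.kSel P + 1)))
    (h12mass : ∀ P : B12.RunParams, lamW.kSel P < P.K → ∀ s, LiveSeq F N Θ.ν Θ.τ9 P (gOfRecord₁₃ F N (Θ.liveRepin₁₃ F N) P) (lamW.kSel P + 1)
        (slotsTOfRecord F N Θ.ν Θ.τ9 (EOfRecord₁₃ F N (Θ.liveRepin₁₃ F N)) (wOfRecord₉ F N (Θ.liveRepin₁₃ F N).toStage9Params)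
          (Θ.liveRepin₁₃ F N).ppSel P (gOfRecord₁₃ F N (Θ.liveRepin₁₃ F N) P) (lamW.kSel P + 1)) s →
      0 < ∫ V, rterm (reprTOfRecord₁₃ F N (Θ.liveRepin₁₃ F N) P (lamW.kSel P)) s V ∂(fieldMeasure (F.P P.K) (lamW.kSel P + 1) (SU N)))
    (h12P1 : ∀ P : B12.RunParams, lamW.kSel P < P.K → Prop1Printed (lamW.LF P))
    (h12i180 : ∀ P : B12.RunParams, lamW.kSel P < P.K → ∀ U, new189 (lamW.D189 P) U → ∀ i, (lamW.D189 P).h ≤ i → i ≤ (lamW.D189 P).k →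
      ∀ q ∈ plaqsOf (dom (lamW.D189 P) i),
        Ineq180 ((lamW.D189 P).dev0 U q) ((lamW.D189 P).ε (lamW.D189 P).k) (lamW.D189 P).η (lamW.D189 P).B₃ (lamW.D189 P).B₅ (lamW.D189 P).M (lamW.D189 P).δ
          ((lamW.D189 P).dist q) (lamW.D189 P).O1)
    (h12c189 : ∀ P : B12.RunParams, lamW.kSel P < P.K → Claim189 (new189 (lamW.D189 P)) (chiPP (lamW.D189 P)))
    (hsel : ∀ P : B12.RunParams, 1 ≤ P.K → lamW.kSel P < P.K) :
    ∃ (θ' : Stage13HParams F N) (h' : θ'.Provisos₁₃SepCoPH F N) (w : WorldP), (θ'.ZhUnity F N ∧ θ'.SlotsNondegenerate₁₃ F N) ∧ θ'.Admissible F N ∧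
      (∃ (θ'' : Stage13HParams F N) (h'' : θ''.Provisos₁₃SepCoPH F N), θ''.Admissible F N ∧
        datumOfRecord₁₃SepCoPH F N θ' h' = datumOfRecord₁₃SepCoPH F N θ'' h'' ∧ w.C = (datumOfRecord₁₃SepCoPH F N θ' h').C ∧ (0 < w.γ ∧ w.γ ≤ θ''.γ) ∧
        w.L = (θ''.L : ℝ) ∧ ∀ P : B12.RunParams, w.up P = upOfRecord₅CS F N (θ''.toStage5₁₃CoPH F N) P) ∧
      (∀ P : B12.RunParams, Dag.B15_main (leavesP w P)) ∧
      ∃ lam : ResidW F N, (∀ P : B12.RunParams, 1 ≤ P.K → lam.kSel P < P.K) ∧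
        ∀ P : B12.RunParams, lam.kSel P < P.K → ((leavesP w P).rBasicStep ↔ B15Leaf (WOfRecord₁₃ F N θ'.toStage13Params lam P)) := by
  obtain ⟨-, -, -, w, hRS, -, -, -, hN, hpin⟩ := exists_mixedPinWS_recordS₁₃SepCoPH_b15_main_pinnedN12_of_leafBelow (⟨⟨Θ.liveRepin₁₃ F N, Zr⟩, Zh, Phih⟩ : Stage13HParams F N) hP hθ.liveRepin₁₃ lamW
    ⟨hθ.toStage9.gamma_pos, le_rfl⟩ fun P hk =>
      b15Leaf_WOfRecord₁₃_liveRepin₁₃_of_massLive_of_hasResiduals Θ lamW hres hk (h12pin P hk) (h12mass P hk) (h12P1 P hk) (h12i180 P hk) (h12c189 P hk)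
  exact ⟨(⟨⟨Θ.liveRepin₁₃ F N, Zr⟩, Zh, Phih⟩ : Stage13HParams F N), hP, w, ⟨hZh, Stage13Params.slotsNondegenerate₁₃_liveRepin_of_hasResiduals hres⟩, hθ.liveRepin₁₃, hRS, hN, lamW, hsel, hpin⟩

end LiveExtension

/-! ## §3 ★★ AT THE DOOR-CURED PIN `Stage13HParams.ofHistoryBlind F N (Stage13RParams.ofCured F N (Θ.liveRepin₁₃ F N))` (FILE 27 §H1 ∘ K0a FILE 18) — `ZhUnity` a THEOREM, the v1.7 provisos from the v1.5 ones (`.ofCured.ofHistoryBlind`) -/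

section Cured
variable (Θ : Stage13Params F N) (lamW : ResidW F N)

/-- **★★ THE K1⁷ v5 RUNG RESTRICTED TO N12, WITNESSED AT THE DOOR-CURED PIN OF THE LIVE RE-PIN — `ZhUnity` DISCHARGED** (`(zrUnity_ofCured _).ofHistoryBlind`, hypothesis-free; §2 at `Zr := ZrOfRecord₁₃ F N (Θ.liveRepin₁₃ F N)`,
`Zh := fun p _ _ _ => Zr p`, `Phih := fun p _ _ _ => (Rz p.K).phi`, `rfl`): K1⁷-SIDE INPUT = the v1.5 package `hP : (Θ.liveRepin₁₃).Provisos₁₃SepCoP` (K1⁵'s input VERBATIM, lifted by K0a's `Provisos₁₃SepCoP.ofCured` and def-T's `Provisos₁₃SepCoPR.ofHistoryBlind`) and admissibility of `Θ`; N12's per-run displays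
below the torus; `hsel`.  The K0⁶ witnesses of record ARE cured pins of such live families (K0a FILE 18 §3–§4) and their door images are the K0⁷ ones (bridge ⁷ ⇐ ⁶ `IsRecordOfRecord₁₃CSepCoPH.ofCoPR`), so this is the N12 row of the rung ON THE K0⁷ → K1⁷ ROAD.  NOT the stub; count-neutral.
[cite: Balaban1989LargeFieldII, Thm 1 p.355, (0.1) pp.355–356, p.391; Balaban1989LargeFieldI, (0.1) p.175, (0.2)–(0.6) p.176, p.177 (i)–(ii), Prop. 1 (1.78) p.194, (1.80) p.195, (1.89) p.198, (1.99)–(1.102) pp.200–201; Balaban1988Convergent, (1.11) p.248, (3.16)–(3.25) pp.268–270; Balaban1985RegularSpaces, Thm 8 p.101 (bookkeeping)] -/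
theorem exists_guarded_recordS₁₃SepCoPH_b15_main_pinnedN12_ofHistoryBlind_ofCured_liveRepin₁₃_of_massLive_of_hasResiduals (hres : Θ.HasResidualsOfRecord F N)
    (hP : (Θ.liveRepin₁₃ F N).Provisos₁₃SepCoP F N) (hθ : Θ.Admissible F N)
    (h12pin : ∀ P : B12.RunParams, lamW.kSel P < P.K → lamW.D1100 P
      = rPrimeDataOfSel (reprTOfRecord₁₃ F N (Θ.liveRepin₁₃ F N) P (lamW.kSel P))
          ((Θ.liveRepin₁₃ F N).ppSel P (gOfRecord₁₃ F N (Θ.liveRepin₁₃ F N) P) (lamW.kSel P + 1))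
          (fibOfSeq F (Θ.liveRepin₁₃ F N).ν (Θ.liveRepin₁₃ F N).τ9 P (gOfRecord₁₃ F N (Θ.liveRepin₁₃ F N) P) (lamW.kSel P + 1)))
    (h12mass : ∀ P : B12.RunParams, lamW.kSel P < P.K → ∀ s, LiveSeq F N Θ.ν Θ.τ9 P (gOfRecord₁₃ F N (Θ.liveRepin₁₃ F N) P) (lamW.kSel P + 1)
        (slotsTOfRecord F N Θ.ν Θ.τ9 (EOfRecord₁₃ F N (Θ.liveRepin₁₃ F N)) (wOfRecord₉ F N (Θ.liveRepin₁₃ F N).toStage9Params)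
          (Θ.liveRepin₁₃ F N).ppSel P (gOfRecord₁₃ F N (Θ.liveRepin₁₃ F N) P) (lamW.kSel P + 1)) s →
      0 < ∫ V, rterm (reprTOfRecord₁₃ F N (Θ.liveRepin₁₃ F N) P (lamW.kSel P)) s V ∂(fieldMeasure (F.P P.K) (lamW.kSel P + 1) (SU N)))
    (h12P1 : ∀ P : B12.RunParams, lamW.kSel P < P.K → Prop1Printed (lamW.LF P))
    (h12i180 : ∀ P : B12.RunParams, lamW.kSel P < P.K → ∀ U, new189 (lamW.D189 P) U → ∀ i, (lamW.D189 P).h ≤ i → i ≤ (lamW.D189 P).k →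
      ∀ q ∈ plaqsOf (dom (lamW.D189 P) i),
        Ineq180 ((lamW.D189 P).dev0 U q) ((lamW.D189 P).ε (lamW.D189 P).k) (lamW.D189 P).η (lamW.D189 P).B₃ (lamW.D189 P).B₅ (lamW.D189 P).M (lamW.D189 P).δ
          ((lamW.D189 P).dist q) (lamW.D189 P).O1)
    (h12c189 : ∀ P : B12.RunParams, lamW.kSel P < P.K → Claim189 (new189 (lamW.D189 P)) (chiPP (lamW.D189 P)))
    (hsel : ∀ P : B12.RunParams, 1 ≤ P.K → lamW.kSel P < P.K) :
    ∃ (θ' : Stage13HParams F N) (h' : θ'.Provisos₁₃SepCoPH F N) (w : WorldP), (θ'.ZhUnity F N ∧ θ'.SlotsNondegenerate₁₃ F N) ∧ θ'.Admissible F N ∧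
      (∃ (θ'' : Stage13HParams F N) (h'' : θ''.Provisos₁₃SepCoPH F N), θ''.Admissible F N ∧
        datumOfRecord₁₃SepCoPH F N θ' h' = datumOfRecord₁₃SepCoPH F N θ'' h'' ∧ w.C = (datumOfRecord₁₃SepCoPH F N θ' h').C ∧ (0 < w.γ ∧ w.γ ≤ θ''.γ) ∧
        w.L = (θ''.L : ℝ) ∧ ∀ P : B12.RunParams, w.up P = upOfRecord₅CS F N (θ''.toStage5₁₃CoPH F N) P) ∧
      (∀ P : B12.RunParams, Dag.B15_main (leavesP w P)) ∧
      ∃ lam : ResidW F N, (∀ P : B12.RunParams, 1 ≤ P.K → lam.kSel P < P.K) ∧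
        ∀ P : B12.RunParams, lam.kSel P < P.K → ((leavesP w P).rBasicStep ↔ B15Leaf (WOfRecord₁₃ F N θ'.toStage13Params lam P)) :=
  exists_guarded_recordS₁₃SepCoPH_b15_main_pinnedN12_liveRepin₁₃H_of_massLive_of_hasResiduals Θ (ZrOfRecord₁₃ F N (Θ.liveRepin₁₃ F N)) (fun p _ _ _ => (Stage13RParams.ofCured F N (Θ.liveRepin₁₃ F N)).Zr p)
    (fun p _ _ _ => ((Stage13RParams.ofCured F N (Θ.liveRepin₁₃ F N)).Rz p.K).phi) lamW hres hP.ofCured.ofHistoryBlind hθ (Stage13RParams.zrUnity_ofCured (Θ.liveRepin₁₃ F N)).ofHistoryBlind h12pin h12mass h12P1 h12i180 h12c189 hsel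

end Cured

/-! ## §4 ★★★ AT THE DOOR-CURED PIN OF THE PLAN's `L`-KEYED WITNESS `θ₁₅ᶜ = theta13OfThm1C F N ε₀ ε₂₉ B₃ a₀ a₁` -/

section CuredThm1C
variable (ε₀ ε₂₉ B₃ a₀ a₁ : ℝ) (lamW : ResidW F N)

/-- **★★★ THE K1⁷ v5 RUNG RESTRICTED TO N12 AT THE DOOR-CURED PIN OF THE PLAN's WITNESS `Stage13HParams.ofHistoryBlind F N (Stage13RParams.ofCured F N θ₁₅ᶜ)`, `θ₁₅ᶜ = theta13OfThm1C F N ε₀ ε₂₉ B₃ a₀ a₁`** (§3 at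
`Θ := theta13OfNumerics … (stage12NumericsOfThm1C F.L ε₀ B₃ a₀ a₁) …`, whose ₁₃ live re-pin IS `θ₁₅ᶜ`; K0b's residuals, admissibility and `ZhUnity` THEOREMS of node00-def-K0a): K1⁷-SIDE INPUT = the v1.5
`hP : Provisos₁₃SepCoP θ₁₅ᶜ` ALONE; the layer `lamW`, its selector bound `hsel` and N12's per-run displays below the torus.  NOT the stub; count-neutral. [cite: Balaban1989LargeFieldII, Thm 1 p.355, (0.1) pp.355–356, p.391; Balaban1989LargeFieldI, (0.1) p.175, (0.2)–(0.6) p.176, p.177 (i)–(ii), Prop. 1 (1.78) p.194, (1.80) p.195, (1.89) p.198, (1.99)–(1.102) pp.200–201; Balaban1988Convergent, (1.11) p.248, (2.10) p.256, (3.16)–(3.25) pp.268–270; Balaban1985Variational, Thm 1 p.279 (witness letters only)] -/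
theorem exists_guarded_recordS₁₃SepCoPH_b15_main_pinnedN12_ofHistoryBlind_ofCured_theta13OfThm1C_of_massLive (hε : 0 < ε₀) (hε' : 0 < ε₂₉) (hB : 0 ≤ B₃) (ha₀ : 0 < a₀) (ha₁ : 0 < a₁)
    (hP : (theta13OfThm1C F N ε₀ ε₂₉ B₃ a₀ a₁).Provisos₁₃SepCoP F N)
    (h12pin : ∀ P : B12.RunParams, lamW.kSel P < P.K → lamW.D1100 P
      = rPrimeDataOfSel (reprTOfRecord₁₃ F N (theta13OfThm1C F N ε₀ ε₂₉ B₃ a₀ a₁) P (lamW.kSel P))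
          ((theta13OfThm1C F N ε₀ ε₂₉ B₃ a₀ a₁).ppSel P (gOfRecord₁₃ F N (theta13OfThm1C F N ε₀ ε₂₉ B₃ a₀ a₁) P) (lamW.kSel P + 1))
          (fibOfSeq F (theta13OfThm1C F N ε₀ ε₂₉ B₃ a₀ a₁).ν (theta13OfThm1C F N ε₀ ε₂₉ B₃ a₀ a₁).τ9 P (gOfRecord₁₃ F N (theta13OfThm1C F N ε₀ ε₂₉ B₃ a₀ a₁) P) (lamW.kSel P + 1)))
    (h12mass : ∀ P : B12.RunParams, lamW.kSel P < P.K → ∀ s, LiveSeq F N (theta13OfThm1C F N ε₀ ε₂₉ B₃ a₀ a₁).ν (theta13OfThm1C F N ε₀ ε₂₉ B₃ a₀ a₁).τ9 P (gOfRecord₁₃ F N (theta13OfThm1C F N ε₀ ε₂₉ B₃ a₀ a₁) P) (lamW.kSel P + 1)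
        (slotsTOfRecord F N (theta13OfThm1C F N ε₀ ε₂₉ B₃ a₀ a₁).ν (theta13OfThm1C F N ε₀ ε₂₉ B₃ a₀ a₁).τ9 (EOfRecord₁₃ F N (theta13OfThm1C F N ε₀ ε₂₉ B₃ a₀ a₁)) (wOfRecord₉ F N (theta13OfThm1C F N ε₀ ε₂₉ B₃ a₀ a₁).toStage9Params)
          (theta13OfThm1C F N ε₀ ε₂₉ B₃ a₀ a₁).ppSel P (gOfRecord₁₃ F N (theta13OfThm1C F N ε₀ ε₂₉ B₃ a₀ a₁) P) (lamW.kSel P + 1)) s →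
      0 < ∫ V, rterm (reprTOfRecord₁₃ F N (theta13OfThm1C F N ε₀ ε₂₉ B₃ a₀ a₁) P (lamW.kSel P)) s V ∂(fieldMeasure (F.P P.K) (lamW.kSel P + 1) (SU N)))
    (h12P1 : ∀ P : B12.RunParams, lamW.kSel P < P.K → Prop1Printed (lamW.LF P))
    (h12i180 : ∀ P : B12.RunParams, lamW.kSel P < P.K → ∀ U, new189 (lamW.D189 P) U → ∀ i, (lamW.D189 P).h ≤ i → i ≤ (lamW.D189 P).k →
      ∀ q ∈ plaqsOf (dom (lamW.D189 P) i),
        Ineq180 ((lamW.D189 P).dev0 U q) ((lamW.D189 P).ε (lamW.D189 P).k) (lamW.D189 P).η (lamW.D189 P).B₃ (lamW.D189 P).B₅ (lamW.D189 P).M (lamW.D189 P).δ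
          ((lamW.D189 P).dist q) (lamW.D189 P).O1)
    (h12c189 : ∀ P : B12.RunParams, lamW.kSel P < P.K → Claim189 (new189 (lamW.D189 P)) (chiPP (lamW.D189 P)))
    (hsel : ∀ P : B12.RunParams, 1 ≤ P.K → lamW.kSel P < P.K) :
    ∃ (θ' : Stage13HParams F N) (h' : θ'.Provisos₁₃SepCoPH F N) (w : WorldP), (θ'.ZhUnity F N ∧ θ'.SlotsNondegenerate₁₃ F N) ∧ θ'.Admissible F N ∧
      (∃ (θ'' : Stage13HParams F N) (h'' : θ''.Provisos₁₃SepCoPH F N), θ''.Admissible F N ∧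
        datumOfRecord₁₃SepCoPH F N θ' h' = datumOfRecord₁₃SepCoPH F N θ'' h'' ∧ w.C = (datumOfRecord₁₃SepCoPH F N θ' h').C ∧ (0 < w.γ ∧ w.γ ≤ θ''.γ) ∧
        w.L = (θ''.L : ℝ) ∧ ∀ P : B12.RunParams, w.up P = upOfRecord₅CS F N (θ''.toStage5₁₃CoPH F N) P) ∧
      (∀ P : B12.RunParams, Dag.B15_main (leavesP w P)) ∧
      ∃ lam : ResidW F N, (∀ P : B12.RunParams, 1 ≤ P.K → lam.kSel P < P.K) ∧
        ∀ P : B12.RunParams, lam.kSel P < P.K → ((leavesP w P).rBasicStep ↔ B15Leaf (WOfRecord₁₃ F N θ'.toStage13Params lam P)) :=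
  exists_guarded_recordS₁₃SepCoPH_b15_main_pinnedN12_ofHistoryBlind_ofCured_liveRepin₁₃_of_massLive_of_hasResiduals
    (theta13OfNumerics F N (stage12NumericsOfThm1C F.L ε₀ B₃ a₀ a₁) ε₂₉
      (zeta316OfRecord F N (stage12NumericsOfThm1C F.L ε₀ B₃ a₀ a₁).ν (stage12NumericsOfThm1C F.L ε₀ B₃ a₀ a₁).τ9.M (stage12NumericsOfThm1C F.L ε₀ B₃ a₀ a₁).A₁)
      (RzOfRecord F N) (ZtOfRecord F N)) lamW
    (hasResidualsOfRecord_theta13OfNumerics F N (stage12NumericsOfThm1C F.L ε₀ B₃ a₀ a₁) ε₂₉) hP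
    (admissible_theta13OfNumerics F N (zeta316OfRecord F N (stage12NumericsOfThm1C F.L ε₀ B₃ a₀ a₁).ν (stage12NumericsOfThm1C F.L ε₀ B₃ a₀ a₁).τ9.M
      (stage12NumericsOfThm1C F.L ε₀ B₃ a₀ a₁).A₁) (RzOfRecord F N) (ZtOfRecord F N) (stage12NumericsOfThm1C_pos hε hB ha₀ ha₁) hε')
    h12pin h12mass h12P1 h12i180 h12c189 hsel

end CuredThm1C

end Summit.QuantumFields.YangMills.BalabanUVNodes.N12AtRecord13SepCoPHS
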